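import Summits.RiemannHypothesis.RiemannHypothesis.Theorems.SignConeConeMagnificationSplit
import Summits.RiemannHypothesis.RiemannHypothesis.Theorems.SignConeSlackDesign
import Summits.RiemannHypothesis.RiemannHypothesis.Theorems.SignConeConeMagnificationDeficitBound

/-!
# Unit slack ⇒ prime deficit at most `2`: the quantitative conclusion of the magnification theorem at `M = 1`
(supports item stmt-RiemannHypothesis-16303, route route-RiemannHypothesis-SignCone, crux `SignCone.ConeMagnification`; HELPER)

The crux `ConeMagnification` and its proof `ConeMagnification_proof` conclude RH from a unit-slack weight at every cutoff;
the registered composition exports, at Step 11, only the SUMMABILITY of the one-sided prime deficit.  The sign-cone paper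
states the magnification theorem with the displayed bound `Σ_p (log p − c(p))₊/√p ≤ 2M`.  This file proves that bound
at `M = 1` as ONE theorem over a single weight: if `c ≥ 0`, `c 1 = 0` and `c` has unit slack against every Weil test
(`-‖g‖₂² ≤ Re(W_ar(g ⋆ g̃) − P_c(g ⋆ g̃))`), then `Σ_p (log p − c(p))₊/√p` converges and is `≤ 2`.
Proof = the first lines of `ConeMagnification_of_subs` (fake PNT `stub_fakePNT`, Chebyshev `stub_chebyshev`,
continuation `stub_continuation`, Laplace positivity `stub_pdLaplace`, Carathéodory `stub_cara` — the last three only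
to feed the two unused binders of `SlackDesign`), the analytic core `SlackDesign_of` (unit slack ⇒ design data
AX-A/B/C), and `deficitOfDesign_tsum_le_two` (design data ⇒ the bound, `z → ∞` in `Design.deficit_partial_le`).

Written 2026-08-17 by the W-MAG paper seat (unit pub-signcone-2) in answer to referee point G2 of
`run/shared/lean/pub/pub-signcone/REFEREE.md`; no new axioms, no sorry.
-/

noncomputable section

-- `Summit.RiemannHypothesis.RiemannHypothesis.…` repeats a namespace component by design (D-0017 layout).
set_option linter.dupNamespace false

open scoped BigOperators ComplexConjugate Topology
open Complex MeasureTheory Set Filter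

namespace Summit.RiemannHypothesis.RiemannHypothesis.Theorems.SignConeConeMagnification

open Literature.NumberTheory.LFunctions
open Summit.RiemannHypothesis.RiemannHypothesis.Theorems.SignCone
open Summit.RiemannHypothesis.RiemannHypothesis.Cruxes.ConeMagnification.Sketch
open Summit.RiemannHypothesis.RiemannHypothesis.Cruxes.SlackDesign.RealCombType

/-- **Magnification theorem, quantitative conclusion at `M = 1`** (2001 W-MAG Thm 1.2(i)): a weight `c ≥ 0` with
`c 1 = 0` and unit slack against every Weil test has one-sided prime deficit `Σ_p (log p − c(p))₊/√p ≤ 2`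
(and the series converges). [folklore] -/
theorem prime_deficit_le_two_of_unitSlack (c : ℕ → ℝ) (hc0 : ∀ n, 0 ≤ c n) (hc1 : c 1 = 0)
    (hU : ∀ g : ℝ → ℂ, IsWeilTest g →
      -(∫ t, ‖g t‖ ^ 2) ≤
        (weilPolarTerm (weilConv g (weilReflect g)) + weilArchTerm (weilConv g (weilReflect g)) -
          ∑' n : ℕ, ((c n : ℝ) : ℂ) / (Real.sqrt n : ℂ) *
            (weilConv g (weilReflect g) (Real.log n) + weilConv g (weilReflect g) (-Real.log n))).re) :
    Summable (fun p : ℕ => if p.Prime then max (Real.log p - c p) 0 / Real.sqrt p else 0) ∧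
      ∑' p : ℕ, (if p.Prime then max (Real.log p - c p) 0 / Real.sqrt p else 0) ≤ 2 := by
  -- fake PNT with O(1) error, Chebyshev (σ > 1), continuation of `L_c − 1/(s−1)` to `re s > 1/2`
  have hPNT := stub_fakePNT c hc0 hU
  have hsum := stub_chebyshev c hc0 hPNT
  have hcont := stub_continuation c hc0 hPNT hsum
  -- Laplace positivity and the Carathéodory majorant (only to instantiate the unused binders of `SlackDesign`)
  have hPD := stub_pdLaplace c hc0 hU
  have hF := stub_cara c hc0 hc1 hU hsum hcont hPD
  -- the analytic core: unit slack ⇒ design data (AX-A), (AX-B), (AX-C)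
  obtain ⟨hA, hB, hC⟩ := SlackDesign_of c hc0 hc1 hU hsum hF
  -- the finite spine with its constant
  exact deficitOfDesign_tsum_le_two c hc0 hc1 hA hB hC

end Summit.RiemannHypothesis.RiemannHypothesis.Theorems.SignConeConeMagnification

end
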